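import Literature.AlgebraicGeometry.Resolution.HironakaDirectrixPrincipal
import Literature.RingTheory.MvPolynomial.DirectrixLinForm
import HarnessLib

/-!
# [OURS · L1 W4.2] The `e = 1` door through the arc, step 1/3 — **a variable splitting off the cone stays off the directrix**
# (polynomial algebra of «`e = 1` near steps are FREE» in the hypersurface cell; crux `SigmaMaxModifications`
# stmt-ResolutionOfSingularities-18506 / conjunct stmt-…-19249, line `w_ladder`, row `stub_Wlow3M_two` (β); `--supports 19249`, helper)

Stub worker res-L1-w42-stub-3 (gen 5). Sorry-free PROOF file, no definition, no named fact; pure polynomial algebra over a field.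
OURS bookkeeping for the W4.2 crux chain (cell res-hironaka); NOT a statement of [Hironaka2017] nor of [CossartJannsenSaito2020].
AI-written; AI review is weaker than expert review.

THE LEMMA. `S = k[X_1, …, X_n]`, `j` an index, `F` a NON-ZERO FORM whose directrix space (CJS Lemma 2.7, tree
`Literature.RingTheory.MvPolynomial.directrixSpace`) is EXACTLY the coordinate hyperplane `⊕_{i ≠ j} k X_i` (so `F ∈ k[X_i : i ≠ j]`
needs all of these variables: `e((F)) = 1`, the directrix is the `X_j`-axis), and `G` arbitrary with `P := F + X_j·G` a non-zero form.
THEN `X_j ∈ 𝒯((P))` forces `𝒯((P)) = S_1`, i.e. `e((P)) = 0` (`directrixSpace_eq_one_of_X_mem`, `directrixDim_eq_zero_of_X_mem`);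
contrapositively **`e((P)) ≥ 1 ⇒ X_j ∉ 𝒯((P))`** (`X_notMem_directrixSpace_of_directrixDim_pos`). Proof: `𝒯((P)) =: W` directs the
principal homogeneous ideal `(P)`, so `P ∈ k[W]` (tree `mem_linearFormsSubalgebra_of_span_singleton_eq`); kill `X_j`
(`ε : X_j ↦ 0`, `X_i ↦ X_i`): `ε P = F`, and `ε W ⊆ W` because `X_j ∈ W`; hence `F ∈ k[ε W]`, `𝒯((F)) ⊆ ε W ⊆ W`, and with `X_j ∈ W`
all variables lie in `W`.

USE (parts 2/3, 3/3). At a near point `x′ = ℙ(Dir_x)` of the blow-up of a hypersurface singularity `𝒪_{X,x} = R/(h)` with `e_x = 1`,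
the strict transform has initial form `in(h′) = F(Y′) + U·G` with `U` the exceptional parameter and `F = in(h)` read in the
directrix-adapted parameters; so `U ∉ 𝒯(x′)` as soon as `e_{x′} ≥ 1` — the next near point `ℙ(Dir_{x′})` lies in the `U`-chart:
the step is NOT a satellite step (res-L1-w42-stub-4 PLANNING NOTE 2026-08-27T13:06:39Z; the general-`X` statement is CJS Thm. 9.3,
not attempted). [OURS · L1 W4.2; AI-written] [cite: CossartJannsenSaito2020, Lemma 2.7, Def. 2.8, Thm. 9.3]
-/

set_option linter.dupNamespace false

noncomputable section

open MvPolynomial Module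
open Literature.RingTheory.MvPolynomial Literature.AlgebraicGeometry.Resolution

namespace Summit.ResolutionOfSingularities.ResolutionOfSingularities.Theorems.SigmaMaxModificationsCorridor3.E1Free

universe u

variable {K : Type u} [Field K] {n : ℕ}

/-- **A subspace of linear forms directing a principal homogeneous ideal contains the generator in its algebra**: if `W` directs
`(P)` for a non-zero form `P`, then `P ∈ k[W]` (CJS Lemma 2.7, principal case; tree `mem_linearFormsSubalgebra_of_span_singleton_eq`
moved from Hironaka's encoding of linear forms to subspaces of `S_1`). [cite: CossartJannsenSaito2020, Lemma 2.7] -/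
theorem mem_adjoin_of_directs_span_singleton {P : MvPolynomial (Fin n) K} {b : ℕ} (hP : P.IsHomogeneous b) (h0 : P ≠ 0)
    {W : Submodule K (MvPolynomial (Fin n) K)} (hW : Directs (Ideal.span {P}) W) :
    P ∈ Algebra.adjoin K (W : Set (MvPolynomial (Fin n) K)) := by
  have hmap : (W.comap (linearFormPolyₗ K)).map (linearFormPolyₗ K) = W := map_comap_linearFormPolyₗ K hW.le_one
  rw [← hmap] at hW ⊢
  obtain ⟨S, hSU, hSI⟩ := directs_map_iff.mp hW
  rw [adjoin_map_linearFormPolyₗ]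
  exact mem_linearFormsSubalgebra_of_span_singleton_eq hP h0 hSU hSI

/-- A non-zero form lies in the algebra of its directrix space: `F ∈ k[𝒯((F))]`. [cite: CossartJannsenSaito2020, Lemma 2.7] -/
theorem mem_adjoin_directrixSpace_span_singleton {F : MvPolynomial (Fin n) K} {b : ℕ} (hF : F.IsHomogeneous b) (h0 : F ≠ 0) :
    F ∈ Algebra.adjoin K (directrixSpace (Ideal.span {F}) : Set (MvPolynomial (Fin n) K)) :=
  mem_adjoin_of_directs_span_singleton hF h0 (directs_directrixSpace _)

/-! ### The substitution killing one variable: `ε_j = aeval (X with X_j := 0)` (no new definition: written out) -/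

/-- `ε_j X_j = 0`. [folklore] -/
theorem aeval_update_X_self (j : Fin n) :
    aeval (Function.update (X : Fin n → MvPolynomial (Fin n) K) j 0) (X j : MvPolynomial (Fin n) K) = 0 := by
  simp

/-- `ε_j X_i = X_i` for `i ≠ j`. [folklore] -/
theorem aeval_update_X_of_ne {j i : Fin n} (h : i ≠ j) :
    aeval (Function.update (X : Fin n → MvPolynomial (Fin n) K) j 0) (X i : MvPolynomial (Fin n) K) = X i := by
  simp [h]

/-- `ε_j` fixes every polynomial not involving `X_j`. [folklore] -/
theorem aeval_update_of_mem_supported {j : Fin n} {F : MvPolynomial (Fin n) K} (hF : F ∈ supported K {i | i ≠ j}) :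
    aeval (Function.update (X : Fin n → MvPolynomial (Fin n) K) j 0) F = F := by
  rw [mem_supported] at hF
  have h := MvPolynomial.hom_congr_vars
    (f₁ := (aeval (Function.update (X : Fin n → MvPolynomial (Fin n) K) j 0)).toRingHom) (f₂ := RingHom.id _)
    (p₁ := F) (p₂ := F) (by ext a; simp) (fun i hi _ => by
      have hij : i ≠ j := hF hi
      simp [hij]) rfl
  simpa using h

/-- `ε_j` of a linear form: the `X_j`-coefficient is killed. [folklore] -/
theorem aeval_update_linForm (j : Fin n) (v : Fin n → K) :
    aeval (Function.update (X : Fin n → MvPolynomial (Fin n) K) j 0) (linForm v) = linForm (Function.update v j 0) := by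
  rw [linForm_apply, linForm_apply, map_sum]
  refine Finset.sum_congr rfl fun i _ => ?_
  rw [map_smul]
  rcases eq_or_ne i j with rfl | h
  · simp
  · simp [h]

/-- `linForm (v with v_j := 0) = linForm v − v_j X_j`. [folklore] -/
theorem linForm_update_zero (j : Fin n) (v : Fin n → K) :
    linForm (Function.update v j 0) = linForm v - v j • (X j : MvPolynomial (Fin n) K) := by
  have hv : Function.update v j 0 = v - v j • (Pi.single j (1 : K) : Fin n → K) := by
    funext i
    rcases eq_or_ne i j with rfl | h
    · simp
    · simp [h]
  rw [hv, map_sub, map_smul, linForm_single]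

/-- **If `X_j ∈ W ⊆ S_1` then `ε_j W ⊆ W`.** [folklore] -/
theorem aeval_update_mem_of_X_mem {j : Fin n} {W : Submodule K (MvPolynomial (Fin n) K)}
    (hW1 : W ≤ homogeneousSubmodule (Fin n) K 1) (hX : (X j : MvPolynomial (Fin n) K) ∈ W)
    {w : MvPolynomial (Fin n) K} (hw : w ∈ W) :
    aeval (Function.update (X : Fin n → MvPolynomial (Fin n) K) j 0) w ∈ W := by
  obtain ⟨v, rfl⟩ := exists_eq_linForm_of_mem (hW1 hw)
  rw [aeval_update_linForm, linForm_update_zero]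
  exact W.sub_mem hw (W.smul_mem _ hX)

/-- **THE LEMMA (directrix-space form).** `F` a non-zero form with `𝒯((F)) = ⊕_{i ≠ j} k X_i`, `P = F + X_j G` a non-zero form:
if `X_j ∈ 𝒯((P))` then `𝒯((P)) = S_1`. [OURS · L1 W4.2; AI-written] [cite: CossartJannsenSaito2020, Lemma 2.7, Def. 2.8] -/
theorem directrixSpace_eq_one_of_X_mem {j : Fin n} {F G : MvPolynomial (Fin n) K} {b : ℕ}
    (hF : F.IsHomogeneous b) (hF0 : F ≠ 0)
    (hTF : directrixSpace (Ideal.span {F}) = Submodule.span K (X '' {i | i ≠ j}))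
    (hP : (F + X j * G).IsHomogeneous b) (hP0 : F + X j * G ≠ 0)
    (hX : (X j : MvPolynomial (Fin n) K) ∈ directrixSpace (Ideal.span {F + X j * G})) :
    directrixSpace (Ideal.span {F + X j * G}) = homogeneousSubmodule (Fin n) K 1 := by
  set W := directrixSpace (Ideal.span {F + X j * G}) with hWdef
  have hW1 : W ≤ homogeneousSubmodule (Fin n) K 1 := directrixSpace_le_one _
  refine le_antisymm hW1 ?_
  -- `P ∈ k[W]`
  have hPW : F + X j * G ∈ Algebra.adjoin K (W : Set (MvPolynomial (Fin n) K)) :=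
    mem_adjoin_of_directs_span_singleton hP hP0 (directs_directrixSpace _)
  -- `F ∈ k[X_i : i ≠ j]`, so `ε_j P = F`
  have hFsupp : F ∈ supported K {i | i ≠ j} := by
    have h := mem_adjoin_directrixSpace_span_singleton hF hF0
    rw [hTF] at h
    rwa [← adjoin_span_X]
  set ε : MvPolynomial (Fin n) K →ₐ[K] MvPolynomial (Fin n) K :=
    aeval (Function.update (X : Fin n → MvPolynomial (Fin n) K) j 0) with hεdef
  have hεP : ε (F + X j * G) = F := by
    rw [map_add, map_mul, hεdef, aeval_update_X_self, zero_mul, add_zero, aeval_update_of_mem_supported hFsupp]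
  -- `F ∈ k[ε_j W]` and `ε_j W ⊆ W`
  set W' : Submodule K (MvPolynomial (Fin n) K) := W.map ε.toLinearMap with hW'def
  have hW'W : W' ≤ W := by
    rintro _ ⟨w, hw, rfl⟩
    exact aeval_update_mem_of_X_mem hW1 hX hw
  have hFW' : F ∈ Algebra.adjoin K (W' : Set (MvPolynomial (Fin n) K)) := by
    have hcoe : (W' : Set (MvPolynomial (Fin n) K)) = ε '' (W : Set (MvPolynomial (Fin n) K)) := by
      rw [hW'def, Submodule.map_coe]; rfl
    rw [hcoe, Algebra.adjoin_image]
    exact Subalgebra.mem_map.mpr ⟨_, hPW, hεP⟩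
  -- hence `W'` directs `(F)` and `𝒯((F)) ⊆ W' ⊆ W`
  have hdirF : Directs (Ideal.span {F}) W' := by
    refine directs_iff_exists_span.mpr ⟨hW'W.trans hW1, {F}, ?_, rfl⟩
    rintro _ rfl
    exact hFW'
  have hTFW : Submodule.span K (X '' {i | i ≠ j}) ≤ W := hTF ▸ (directrixSpace_le hdirF).trans hW'W
  -- all variables lie in `W`
  rw [homogeneousSubmodule_one_eq_span_X, Submodule.span_le]
  rintro _ ⟨i, rfl⟩
  by_cases hij : i = j
  · subst hij; exact hX
  · exact hTFW (Submodule.subset_span ⟨i, hij, rfl⟩)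

/-- **THE LEMMA (dimension form): `X_j ∈ 𝒯((F + X_j G)) ⇒ e((F + X_j G)) = 0`.** [OURS · L1 W4.2; AI-written]
[cite: CossartJannsenSaito2020, Def. 2.8] -/
theorem directrixDim_eq_zero_of_X_mem {j : Fin n} {F G : MvPolynomial (Fin n) K} {b : ℕ}
    (hF : F.IsHomogeneous b) (hF0 : F ≠ 0)
    (hTF : directrixSpace (Ideal.span {F}) = Submodule.span K (X '' {i | i ≠ j}))
    (hP : (F + X j * G).IsHomogeneous b) (hP0 : F + X j * G ≠ 0)
    (hX : (X j : MvPolynomial (Fin n) K) ∈ directrixSpace (Ideal.span {F + X j * G})) :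
    directrixDim (Ideal.span {F + X j * G}) = 0 := by
  have h := finrank_directrixSpace_add_directrixDim (Ideal.span {F + X j * G})
  rw [directrixSpace_eq_one_of_X_mem hF hF0 hTF hP hP0 hX, finrank_homogeneousSubmodule_one] at h
  omega

/-- **THE LEMMA (contrapositive, the form consumed downstream): `e((F + X_j G)) ≥ 1 ⇒ X_j ∉ 𝒯((F + X_j G))`** — the exceptional
variable `X_j = U` is transversal to the directrix of the strict transform. [OURS · L1 W4.2; AI-written]
[cite: CossartJannsenSaito2020, Def. 2.8, Thm. 9.3] -/
theorem X_notMem_directrixSpace_of_directrixDim_pos {j : Fin n} {F G : MvPolynomial (Fin n) K} {b : ℕ}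
    (hF : F.IsHomogeneous b) (hF0 : F ≠ 0)
    (hTF : directrixSpace (Ideal.span {F}) = Submodule.span K (X '' {i | i ≠ j}))
    (hP : (F + X j * G).IsHomogeneous b) (hP0 : F + X j * G ≠ 0)
    (hpos : 0 < directrixDim (Ideal.span {F + X j * G})) :
    (X j : MvPolynomial (Fin n) K) ∉ directrixSpace (Ideal.span {F + X j * G}) :=
  fun hX => (Nat.pos_iff_ne_zero.mp hpos) (directrixDim_eq_zero_of_X_mem hF hF0 hTF hP hP0 hX)

/-- **The hypothesis `𝒯((F)) = ⊕_{i ≠ j} k X_i` from «`F ∈ k[X_i : i ≠ j]` and `e((F)) = 1`»** (the form it arises in: at a point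
read as the ORIGIN of the `X_j`-chart, the directrix of `e = 1` is the `X_j`-axis). [OURS · L1 W4.2; AI-written]
[cite: CossartJannsenSaito2020, Lemma 2.7, Def. 2.8] -/
theorem directrixSpace_eq_span_X_of_supported {j : Fin n} {F : MvPolynomial (Fin n) K}
    (hle : directrixSpace (Ideal.span {F}) ≤ Submodule.span K (X '' {i | i ≠ j}))
    (hdim : directrixDim (Ideal.span {F}) = 1) :
    directrixSpace (Ideal.span {F}) = Submodule.span K (X '' {i | i ≠ j}) := by
  classical
  haveI : FiniteDimensional K (Submodule.span K (X '' {i | i ≠ j} : Set (MvPolynomial (Fin n) K))) :=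
    FiniteDimensional.span_of_finite K ((Set.toFinite _).image X)
  refine Submodule.eq_of_le_of_finrank_le hle ?_
  have h1 := finrank_directrixSpace_add_directrixDim (Ideal.span {F})
  rw [hdim] at h1
  -- `dim span{X_i : i ≠ j} ≤ n - 1`: it misses the independent vector `X_j`
  have h2 : finrank K (Submodule.span K (X '' {i | i ≠ j} : Set (MvPolynomial (Fin n) K))) + 1 ≤ n := by
    have hXj : (X j : MvPolynomial (Fin n) K) ∉ Submodule.span K (X '' {i | i ≠ j}) :=
      (linearIndependent_X (K := K) (n := n)).notMem_span_image (show j ∉ {i : Fin n | i ≠ j} by simp)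
    have hlt : Submodule.span K (X '' {i | i ≠ j} : Set (MvPolynomial (Fin n) K)) <
        homogeneousSubmodule (Fin n) K 1 :=
      lt_of_le_of_ne (span_X_le_one _) fun h => hXj (h ▸ isHomogeneous_X K j)
    have := Submodule.finrank_lt_finrank_of_lt hlt
    rw [finrank_homogeneousSubmodule_one] at this
    omega
  omega

end Summit.ResolutionOfSingularities.ResolutionOfSingularities.Theorems.SigmaMaxModificationsCorridor3.E1Free

end
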